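import Literature.NumberTheory.Automorphic.ModulusInvariantIntegral
import Literature.NumberTheory.Automorphic.UnitaryAdmissibleCompleteReducibility
import Literature.NumberTheory.Automorphic.InducedWhittakerVanishing
import HarnessLib

/-!
# The invariant Hermitian form on `Ind_H^G(χ δ_H^{1/2})` (`χ` unitary) and complete reducibility

Topic `NumberTheory/Automorphic`; theorems only. Let `G` be a unimodular second countable locally
compact Hausdorff group, `H ≤ G` closed, `K ≤ G` compact open with `G = H K`, and
`σ : H → ℂˣ` a one-dimensional representation with `|σ(p)|² = Δ_H(p)` (i.e. `σ = χ δ_H^{1/2}` with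
`χ` unitary, `δ_H = Δ_H` Mathlib's `modularCharacter` of `↥H`). On the smooth induced representation
`Ind_H^G σ` (H21 `Representation.smoothIndRep`) the form
`⟨f₁, f₂⟩ = ∫_K conj(f₁(k)) f₂(k) dμ_K(k)` is a `G`-INVARIANT positive definite Hermitian form
(`integral_subgroup_comp_mul_right_eq` applied to `h = conj(f₁) f₂`, which lies in `Ind δ_H`), so
every subrepresentation of the (admissible) `Ind_H^G σ` has an invariant complement
(`exists_isCompl_subrepresentation_of_invariant_form`):

* `integral_conj_toFun_mul_toFun_smoothIndRep` — invariance of the form;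
* `toFun_eq_zero_of_forall_mem` — `f|_K = 0 ⇒ f = 0` (as `G = H K`);
* `exists_isCompl_subrepresentation_smoothIndRep_of_norm_sq_eq` — complete reducibility of
  `Ind_H^G(χ δ_H^{1/2})`, `χ` unitary, when it is admissible.

(Bernstein–Zelevinsky 1976, 1.21 and 2.25 (c): "if `π` is unitary then so is `ind(π δ^{1/2})`";
1977, Prop. 1.9 (c) / 2.3; Casselman 1995, Prop. 2.1.5 and §3.1.) Used for the irreducibility of
unitary parabolic induction from the maximal parabolic of `GL_N` (Zelevinsky 1980, Thm. 4.2).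

## References

* I. N. Bernstein, A. V. Zelevinsky, Russian Math. Surveys 31:3 (1976), 1.21, 2.25. [BernsteinZelevinskyRMS1976]
* I. N. Bernstein, A. V. Zelevinsky, Ann. Sci. ÉNS 10 (1977), 1.9, 2.3. [BernsteinZelevinskyASENS1977]
-/

noncomputable section

open MeasureTheory Measure Set Filter Topology Function
open scoped ENNReal NNReal Pointwise ComplexConjugate

namespace Literature.NumberTheory.Automorphic

universe u

variable {G : Type u} [Group G] [TopologicalSpace G] [IsTopologicalGroup G]
  {H K : Subgroup G} (σ : Representation ℂ ↥H ℂ)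

/-- An element of `Ind_H^G σ` is a continuous (indeed locally constant) function on `G`.
[cite: BernsteinZelevinskyRMS1976, 2.21] -/
theorem continuous_toFun_smoothInd (f : Representation.SmoothInd H σ) : Continuous f.toFun :=
  (Representation.SmoothInd.isLocallyConstant_toFun f).continuous

omit [TopologicalSpace G] [IsTopologicalGroup G] in
/-- A one-dimensional representation acts by the scalar `σ(p) 1`: `σ p w = w * σ p 1`. [folklore] -/
private theorem apply_eq_self_mul_apply_one (p : ↥H) (w : ℂ) : σ p w = w * σ p 1 := by
  rw [← smul_eq_mul, ← map_smul, smul_eq_mul, mul_one]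

/-- **`f|_K = 0 ⇒ f = 0`** for `f ∈ Ind_H^G σ` when `G = H K` (restriction to `K` is injective on
`Ind_H^G σ`). [cite: BernsteinZelevinskyRMS1976, 2.21] -/
theorem toFun_eq_zero_of_forall_mem (hHK : ∀ g : G, ∃ p ∈ H, ∃ k ∈ K, g = p * k)
    (f : Representation.SmoothInd H σ) (hf : ∀ k ∈ K, f.toFun k = 0) : f = 0 := by
  apply Representation.SmoothInd.ext
  funext g
  obtain ⟨p, hp, k, hk, rfl⟩ := hHK g
  rw [show p * k = ((⟨p, hp⟩ : ↥H) : G) * k from rfl, Representation.SmoothInd.toFun_subgroup_mul,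
    hf k hk, map_zero]
  rfl

variable [MeasurableSpace G] [BorelSpace G]

/-- The restriction to the compact subgroup `K` of `k ↦ conj(f₁(k)) f₂(k)` (`f₁, f₂ ∈ Ind_H^G σ`) is
integrable for a measure finite on compacts (the form `∫_K conj(f₁) f₂` is defined).
[cite: BernsteinZelevinskyRMS1976, 2.25 (c)] -/
theorem integrable_conj_toFun_mul_toFun (hKc : IsCompact (K : Set G)) (μK : Measure ↥K)
    [IsFiniteMeasureOnCompacts μK] (f₁ f₂ : Representation.SmoothInd H σ) :
    Integrable (fun k : ↥K => conj (f₁.toFun (k : G)) * f₂.toFun (k : G)) μK := by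
  haveI : CompactSpace ↥K := isCompact_iff_compactSpace.1 hKc
  have hcont : Continuous fun k : ↥K => conj (f₁.toFun (k : G)) * f₂.toFun (k : G) :=
    ((Complex.continuous_conj.comp ((continuous_toFun_smoothInd σ f₁).comp continuous_subtype_val)).mul
      ((continuous_toFun_smoothInd σ f₂).comp continuous_subtype_val))
  exact integrableOn_univ.1 (hcont.continuousOn.integrableOn_compact' isCompact_univ MeasurableSet.univ)

variable [LocallyCompactSpace G] [T2Space G] [SecondCountableTopology G] [LocallyCompactSpace ↥H]

/-- **`G`-invariance of the form `⟨f₁, f₂⟩ = ∫_K conj(f₁) f₂ dμ_K` on `Ind_H^G(χ δ_H^{1/2})`**,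
`χ` unitary (`|σ(p)|² = Δ_H(p)`), `G = H K` unimodular, `K` compact open.
[cite: BernsteinZelevinskyRMS1976, 2.25 (c)] -/
theorem integral_conj_toFun_mul_toFun_smoothIndRep (hH : IsClosed (H : Set G)) (hKo : IsOpen (K : Set G))
    (hKc : IsCompact (K : Set G)) (hHK : ∀ g : G, ∃ p ∈ H, ∃ k ∈ K, g = p * k)
    (μG : Measure G) [IsHaarMeasure μG] [μG.IsMulRightInvariant] (μK : Measure ↥K) [IsHaarMeasure μK]
    (hσ : ∀ p : ↥H, ‖σ p 1‖ ^ 2 = ((modularCharacter p : ℝ≥0) : ℝ))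
    (g : G) (f₁ f₂ : Representation.SmoothInd H σ) :
    ∫ k : ↥K, conj ((Representation.smoothIndRep H σ g f₁).toFun (k : G)) *
        (Representation.smoothIndRep H σ g f₂).toFun (k : G) ∂μK =
      ∫ k : ↥K, conj (f₁.toFun (k : G)) * f₂.toFun (k : G) ∂μK := by
  simp only [Representation.toFun_smoothIndRep_apply]
  refine integral_subgroup_comp_mul_right_eq hH hKo hKc hHK μG μK
    (fun x => conj (f₁.toFun x) * f₂.toFun x) ?_ ?_ g
  · exact (Complex.continuous_conj.comp (continuous_toFun_smoothInd σ f₁)).mul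
      (continuous_toFun_smoothInd σ f₂)
  · intro p x
    rw [Representation.SmoothInd.toFun_subgroup_mul, Representation.SmoothInd.toFun_subgroup_mul,
      apply_eq_self_mul_apply_one σ p (f₁.toFun x), apply_eq_self_mul_apply_one σ p (f₂.toFun x),
      map_mul]
    have h2 : conj (σ p 1) * σ p 1 = ((modularCharacter p : ℝ≥0) : ℂ) := by
      rw [Complex.conj_mul', ← Complex.ofReal_pow, hσ p]
    calc conj (f₁.toFun x) * conj (σ p 1) * (f₂.toFun x * σ p 1)
        = (conj (σ p 1) * σ p 1) * (conj (f₁.toFun x) * f₂.toFun x) := by ring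
      _ = _ := by rw [h2]

/-- **Complete reducibility of `Ind_H^G(χ δ_H^{1/2})`, `χ` unitary** (when admissible, `G = H K`
unimodular, `K` compact open): every subrepresentation has an invariant complement — the
orthogonal complement for the invariant inner product `∫_K conj(f₁) f₂ dμ_K`.
[cite: BernsteinZelevinskyRMS1976, 2.25 (c)] -/
theorem exists_isCompl_subrepresentation_smoothIndRep_of_norm_sq_eq (hH : IsClosed (H : Set G))
    (hKo : IsOpen (K : Set G)) (hKc : IsCompact (K : Set G))
    (hHK : ∀ g : G, ∃ p ∈ H, ∃ k ∈ K, g = p * k)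
    (μG : Measure G) [IsHaarMeasure μG] [μG.IsMulRightInvariant]
    (hσ : ∀ p : ↥H, ‖σ p 1‖ ^ 2 = ((modularCharacter p : ℝ≥0) : ℝ))
    (hadm : (Representation.smoothIndRep H σ).IsAdmissible)
    (W : Subrepresentation (Representation.smoothIndRep H σ)) :
    ∃ W' : Subrepresentation (Representation.smoothIndRep H σ), IsCompl W.toSubmodule W'.toSubmodule := by
  haveI : LocallyCompactSpace ↥K := hKo.isOpenEmbedding_subtypeVal.locallyCompactSpace
  set μK : Measure ↥K := Measure.haar with hμK
  have hint := integrable_conj_toFun_mul_toFun σ hKc μK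
  have hcontK : ∀ f : Representation.SmoothInd H σ, Continuous fun k : ↥K => f.toFun (k : G) :=
    fun f => (continuous_toFun_smoothInd σ f).comp continuous_subtype_val
  refine exists_isCompl_subrepresentation_of_invariant_form (Representation.smoothIndRep H σ) hadm
    ⟨K, hKo, hKc⟩ (fun f₁ f₂ => ∫ k : ↥K, conj (f₁.toFun (k : G)) * f₂.toFun (k : G) ∂μK)
    ?_ ?_ ?_ ?_ ?_ ?_ W
  · -- additive in the first variable
    intro x y z
    simp only [Representation.SmoothInd.toFun_add, Pi.add_apply, map_add, add_mul]
    exact integral_add (hint x z) (hint y z)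
  · -- conjugate-linear in the first variable
    intro c x y
    simp only [Representation.SmoothInd.toFun_smul, Pi.smul_apply, smul_eq_mul, map_mul, mul_assoc]
    exact integral_const_mul _ _
  · -- Hermitian
    intro x y
    rw [← integral_conj]
    refine integral_congr_ae (Filter.Eventually.of_forall fun k => ?_)
    simp only [map_mul, Complex.conj_conj, mul_comm]
  · -- nonnegative
    intro x
    have : (fun k : ↥K => conj (x.toFun (k : G)) * x.toFun (k : G)) =
        fun k : ↥K => ((‖x.toFun (k : G)‖ ^ 2 : ℝ) : ℂ) := by
      funext k
      rw [Complex.conj_mul', Complex.ofReal_pow]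
    rw [this, integral_complex_ofReal, Complex.ofReal_re]
    exact integral_nonneg fun k => by positivity
  · -- definite
    intro x hx
    have heq : (fun k : ↥K => conj (x.toFun (k : G)) * x.toFun (k : G)) =
        fun k : ↥K => ((‖x.toFun (k : G)‖ ^ 2 : ℝ) : ℂ) := by
      funext k
      rw [Complex.conj_mul', Complex.ofReal_pow]
    rw [heq, integral_complex_ofReal, Complex.ofReal_eq_zero] at hx
    have hcont2 : Continuous fun k : ↥K => ‖x.toFun (k : G)‖ ^ 2 := ((hcontK x).norm).pow 2
    have hint2 : Integrable (fun k : ↥K => ‖x.toFun (k : G)‖ ^ 2) μK := by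
      haveI : CompactSpace ↥K := isCompact_iff_compactSpace.1 hKc
      exact integrableOn_univ.1 (hcont2.continuousOn.integrableOn_compact' isCompact_univ MeasurableSet.univ)
    have hae := (integral_eq_zero_iff_of_nonneg (fun k => by positivity) hint2).1 hx
    have hzero : (fun k : ↥K => ‖x.toFun (k : G)‖ ^ 2) = 0 :=
      (Continuous.ae_eq_iff_eq μK hcont2 continuous_const).1 hae
    refine toFun_eq_zero_of_forall_mem σ hHK x fun k hk => ?_
    have := congrFun hzero ⟨k, hk⟩
    simpa using this
  · -- invariant
    intro g x y
    exact integral_conj_toFun_mul_toFun_smoothIndRep σ hH hKo hKc hHK μG μK hσ g x y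

end Literature.NumberTheory.Automorphic
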